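import Summits.QuantumFields.YangMills.Theorems.BalabanUVNodesN18AveragedFactorLocalGauge
import Summits.QuantumFields.YangMills.Theorems.BalabanUVNodesN18BoxStokesSharp
import HarnessLib

/-!
# BalabanUVNodes ∕ node N18 = NE5 — closure-ledger item (iii): THE C⁰ FACTORISATION LETTERS OF THE TRANSPORTED PAIR, I — the average of the pair minus the
# average of its factor (`‖Ū(𝐔)(c) − Ū(U)(c)‖ ≤ 22·(r + ((1+4ξα₁)^ℓ − 1))`), the logarithm of `X = Ū(𝐔)·Ū(U)⁻¹` at one bond (exp∕trace∕norm∕crude `∇`), and the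
# congruence of condition (i) along the region's bonds
# (Track A, DAG node N18 = `T4OutputRate.NE5` :211; cluster K4 «SpineRates», item K3⁷ `SpineGivenEndpointR13SepCoPH`; seat pub-ymgap-dag-n18-w3 g4)

HONEST FRAMING.  Count-neutral kernel bookkeeping (`--supports stmt-QuantumFields-20544 --as helper`): elementary normed-algebra estimates on W1-18's `avgUnits`
(`val_avgUnits`: `exp[mean log]` of the loops times the straight transporter), FILE 10's factorised-field letters (`norm_holT_factor_sub_holT_le`), this seat's
sharp two-block box Stokes (`…N18BoxStokesSharp`) and FILE D's ★★ `avgUnits_factor_mem_suModel_G`, the tree's matrix logarithm (`MatrixLog.exp_mlog`,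
`norm_mlog_le_two_mul`, `ExpMeanLog.trace_mlog_eq_zero_of_det_eq_one`).  The assembled factorisation at the frames of record is the sequel
`…N18TransportedPairFactorisation`.  Nothing of Bałaban's renormalization group is
asserted; NE5 NOT PRINTED ∕ NOT proved; N18 NOT discharged; nothing about the continuum ∕ OS ∕ mass gap ∕ Clay.

WHAT (run B = `P`, frame `FB`, constants `cB`, `𝐔 = (exp iξA′)·U` with (i) for `U` at `α₀` and (ii) for `A′` at `α₁`; `ℓ = (d+2)L`, `r = (ℓ²∕4)·α₀ξ²`, `ε = 2ξα₁`).
* §1 ★ `norm_avgUnits_sub_avgUnits_factor_le`: at a coarse bond whose two-block bonds ∕ plaquettes lie in the region, `‖Ū(𝐔)(c) − Ū(U)(c)‖ ≤ 22·(r + ((1+2ε)^ℓ − 1))`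
  (`r + ((1+2ε)^ℓ − 1) ≤ 1∕2`); ★ `norm_avgUnits_mul_inv_sub_one_le` (the same for `X = Ū(𝐔)(c)·Ū(U)(c)⁻¹ − 1`, `Ū(U)(c) ∈ SU(N)` by FILE D).
* §2 at one bond: `expI_log_mul_eq` (`exp iξ′·((iξ′)⁻¹ log X)·V = W` for `X = W·V⁻¹`, `‖X − 1‖ < 1`), `trace_log_eq_zero` (`det W = det V = 1`, `‖X − 1‖ ≤ 1∕3`, `N·‖X − 1‖ < π`),
  `norm_log_div_le` (`‖(iξ′)⁻¹ log X‖ ≤ 2ρ∕ξ′`), `norm_nabla_le_two_mul_div` (crude `‖∇^ξ_U A‖ ≤ 2a∕ξ`), `condI_congr_frameI` (condition (i) on a frame of record depends on the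
  factor at the region's bonds only).

0 `def`, 0 `sorry`.  References: T. Bałaban, CMP **109** (1987) 249–301 [Balaban1987RG1] ((0.4) p.253, (1.11)–(1.13) p.262); CMP **98** (1985) 17–51 [Balaban1985Averaging]
((26)–(27) p.22, Prop. 3 (121)–(125) p.36).
-/

noncomputable section

open scoped BigOperators Matrix.Norms.L2Operator

namespace YMDAG.N18.TransportOfRecord

open Complex (I)
open NormedSpace (exp)
open Literature.MathematicalPhysics.QuantumFieldTheory.Balaban1983to89
open Literature.MathematicalPhysics.QuantumFieldTheory.Balaban1983to89.T4Continuum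
open Literature.MathematicalPhysics.QuantumFieldTheory.Balaban1983to89.T4LevelShift
open Literature.MathematicalPhysics.QuantumFieldTheory.Balaban1983to89.BlockAveraging
open Literature.MathematicalPhysics.QuantumFieldTheory.Balaban1983to89.B12RegularSpaces111
open Literature.MathematicalPhysics.QuantumFieldTheory.Balaban1983to89.B12RegularSpaces111SpecialUnitary (suModel mem_suModel_G mem_suModel_Gc mem_suModel_gc
  suModel_norm_le suModel_G_le_Gc)
open Literature.MathematicalPhysics.QuantumFieldTheory.Balaban1983to89.B7Prop1Explicit (U1 mem_U1)
open Literature.MathematicalPhysics.QuantumFieldTheory.Balaban1983to89.ExpMeanLog (eml expMeanLogSU deltaSU)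
open Literature.MathematicalPhysics.QuantumFieldTheory.Balaban1983to89.MatrixLog (mlog exp_mlog norm_mlog_le_two_mul)
open Literature.MathematicalPhysics.QuantumFieldTheory.Balaban1983to89.Node00 (MatA ιSU coe_ιSU ιSU_mem_G)
open Literature.MathematicalPhysics.QuantumFieldTheory.Balaban1983to89.Node00.W1
open Literature.MathematicalPhysics.QuantumFieldTheory.Balaban1983to89.Node00.Sect2 (regionOfSet domSys domSites frameI cubesI)
open Summit.QuantumFields.YangMills.Theorems.Prop8Chart (emlAvgU_congr₂ holT_loopWord_congr₂)
open YMDAG.N18.BoxStokes (norm_loopVarU_sub_one_le_quarter)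

/-! ## §1 The average of the pair minus the average of its factor -/

section Frame

variable {P : Params} {N : ℕ} [NeZero N]

/-- ★ **`‖Ū(𝐔)(c) − Ū(U)(c)‖ ≤ 22·(r + ((1+2ε)^ℓ − 1))`** for `𝐔 = (exp iξA′)·U` with (i) for `U` at `α₀` and (ii) for `A′` at `α₁`, at a coarse bond whose two-block bonds and
plaquettes lie in the region (`r = (ℓ²∕4)·α₀ξ²`, `ε = 2ξα₁`, `ℓ = (d+2)L`; `r + ((1+2ε)^ℓ − 1) ≤ 1∕2`): `Ū = exp[mean log W]·S` (W1-18 `val_avgUnits`); the loops of the factor are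
within `r` of `1` (this seat's sharp box Stokes), those of `𝐔` within `r + ((1+2ε)^ℓ − 1)`, the straight transporters within `(1+2ε)^L − 1` of each other (FILE 10), and
`‖exp[mean log W] − 1‖ ≤ 6t` (`BlockAveragingPlaquetteBound.norm_eml_sub_one_le_six_mul`). [cite: Balaban1985Averaging, (26)-(27) p.22, (122)-(123) p.36; Balaban1987RG1, (0.4) p.253] -/
theorem norm_avgUnits_sub_avgUnits_factor_le (hj : 0 + 1 ≤ P.m + P.K) {FB : Frame P 0 (MatA N)} {cB : StepConsts} {α₀ α₁ : ℝ}
    {Uc U : PBond P 0 → (MatA N)ˣ} {A' : PBond P 0 → MatA N} (hf : Factors cB Uc U A') (hI : CondI (suModel N) FB cB α₀ U)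
    (hII : CondII (suModel N) FB.X cB α₁ U A') (c : PBond P 1)
    (hXb : ∀ b : PBond P 0, (blockOf b.src = c.src ∨ blockOf b.src = c.tgt) → (blockOf b.tgt = c.src ∨ blockOf b.tgt = c.tgt) → b ∈ FB.X.bonds)
    (hXp : ∀ p : Plaq P 0, (blockOf p.src = c.src ∨ blockOf p.src = c.tgt) →
      (blockOf (p.src.shift p.μ) = c.src ∨ blockOf (p.src.shift p.μ) = c.tgt) →
      (blockOf (p.src.shift p.ν) = c.src ∨ blockOf (p.src.shift p.ν) = c.tgt) →
      (blockOf ((p.src.shift p.μ).shift p.ν) = c.src ∨ blockOf ((p.src.shift p.μ).shift p.ν) = c.tgt) → p ∈ FB.X.plaqs)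
    (hξ : 0 ≤ cB.ξ) (hα₀ : 0 ≤ α₀) (hα₁ : 0 ≤ α₁) (hξ₁ : cB.ξ * α₁ ≤ 1 / 4)
    (hsm : ((((P.d + 2) * P.L : ℕ) : ℝ) ^ 2 / 4) * (α₀ * cB.ξ ^ 2) + ((1 + 2 * (2 * (cB.ξ * α₁))) ^ ((P.d + 2) * P.L) - 1) ≤ 1 / 2) :
    ‖((avgUnits Uc c : (MatA N)ˣ) : MatA N) - (avgUnits U c : (MatA N)ˣ)‖ ≤
      22 * (((((P.d + 2) * P.L : ℕ) : ℝ) ^ 2 / 4) * (α₀ * cB.ξ ^ 2) + ((1 + 2 * (2 * (cB.ξ * α₁))) ^ ((P.d + 2) * P.L) - 1)) := by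
  classical
  -- constants
  set r : ℝ := ((((P.d + 2) * P.L : ℕ) : ℝ) ^ 2 / 4) * (α₀ * cB.ξ ^ 2) with hr_def
  set ε : ℝ := 2 * (cB.ξ * α₁) with hε_def
  set Q : ℝ := (1 + 2 * ε) ^ ((P.d + 2) * P.L) - 1 with hQ_def
  have hr0 : 0 ≤ r := by positivity
  have hε0 : 0 ≤ ε := by positivity
  have hε : ε ≤ 1 / 2 := by rw [hε_def]; linarith
  have hQ0 : 0 ≤ Q := by rw [hQ_def]; linarith [one_le_pow₀ (show (1 : ℝ) ≤ 1 + 2 * ε by linarith) (n := (P.d + 2) * P.L)]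
  have hrQ : r + Q ≤ 1 / 2 := hsm
  -- the cut-off fields (two-block locality of the average)
  let χ : PBond P 0 → Prop := fun b => (blockOf b.src = c.src ∨ blockOf b.src = c.tgt) ∧ (blockOf b.tgt = c.src ∨ blockOf b.tgt = c.tgt)
  let Uc' : GaugeField P 0 (MatA N)ˣ := fun b => if χ b then Uc b else 1
  let U' : GaugeField P 0 (MatA N)ˣ := fun b => if χ b then U b else 1
  let e' : GaugeField P 0 (MatA N)ˣ := fun b => if χ b then expI cB.ξ (A' b) else 1
  have hagree : ∀ b : PBond P 0, (blockOf b.src = c.src ∨ blockOf b.src = c.tgt) → (blockOf b.tgt = c.src ∨ blockOf b.tgt = c.tgt) →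
      Uc b = Uc' b := fun b h1 h2 => by simp only [Uc', χ, if_pos (And.intro h1 h2)]
  have hagreeU : ∀ b : PBond P 0, (blockOf b.src = c.src ∨ blockOf b.src = c.tgt) → (blockOf b.tgt = c.src ∨ blockOf b.tgt = c.tgt) →
      U b = U' b := fun b h1 h2 => by simp only [U', χ, if_pos (And.intro h1 h2)]
  have hf' : ∀ b, Uc' b = e' b * U' b := fun b => by
    by_cases hb : χ b
    · simp only [Uc', U', e', if_pos hb]; exact hf b
    · simp only [Uc', U', e', if_neg hb, one_mul]
  have hU'1 : ∀ b, ‖((U' b : (MatA N)ˣ) : MatA N)‖ ≤ 1 := fun b => by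
    by_cases hb : χ b
    · simp only [U', if_pos hb]; exact suModel_norm_le _ (hI.gValued b (hXb b hb.1 hb.2))
    · simp only [U', if_neg hb, Units.val_one, norm_one]; exact le_rfl
  have hU'2 : ∀ b, ‖(((U' b)⁻¹ : (MatA N)ˣ) : MatA N)‖ ≤ 1 := fun b => by
    by_cases hb : χ b
    · simp only [U', if_pos hb]; exact suModel_norm_le _ ((suModel N).G.inv_mem (hI.gValued b (hXb b hb.1 hb.2)))
    · simp only [U', if_neg hb, inv_one, Units.val_one, norm_one]; exact le_rfl
  have hU'm : ∀ b, U' b ∈ U1 (MatA N) := fun b => mem_U1.mpr ⟨hU'1 b, hU'2 b⟩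
  have he' : ∀ b, ‖((e' b : (MatA N)ˣ) : MatA N) - 1‖ ≤ ε := fun b => by
    by_cases hb : χ b
    · simp only [e', if_pos hb]
      have hA : ‖A' b‖ ≤ α₁ := (hII.norm_lt b (hXb b hb.1 hb.2)).le
      have h1 : cB.ξ * ‖A' b‖ ≤ cB.ξ * α₁ := mul_le_mul_of_nonneg_left hA hξ
      exact (norm_coe_expI_sub_one_le hξ (h1.trans (by linarith))).trans (by rw [hε_def]; linarith)
    · simp only [e', if_neg hb, Units.val_one, sub_self, norm_zero]; exact hε0
  -- loops of the cut-off factor (sharp box Stokes) and of the cut-off pair (factorised)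
  have hWU : ∀ i : Idx P, ‖((loopVarU U' c i : (MatA N)ˣ) : MatA N) - 1‖ ≤ r := fun i =>
    norm_loopVarU_sub_one_le_quarter hj c (mul_nonneg hα₀ (sq_nonneg _)) (fun b _ _ => hU'm b) (fun p h1 h2 h3 h4 => by
      have hp := hXp p h1 h2 h3 h4
      have e1 := hagreeU ⟨p.src, p.μ⟩ h1 h2
      have e2 := hagreeU ⟨p.src.shift p.μ, p.ν⟩ h2 h4
      have e3 := hagreeU ⟨p.src.shift p.ν, p.μ⟩ h3 (by rw [PBond.tgt, BlockAveragingEMLProp2.shift_shift_comm p.src p.ν p.μ]; exact h4)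
      have e4 := hagreeU ⟨p.src, p.ν⟩ h1 h3
      rw [← plaq_congr_of_bonds p e1 e2 e3 e4]
      exact (hI.plaq_lt p hp).le) i
  have hWUc : ∀ i : Idx P, ‖((loopVarU Uc' c i : (MatA N)ˣ) : MatA N) - 1‖ ≤ r + Q := fun i => by
    have h1 := norm_holT_factor_sub_holT_le hf' hU'1 hU'2 hε he' (emb c.src) (loopWord P.L c.dir (off i.1) i.2.1 i.2.2)
    have hlen := LatticeWordStokes.length_loopWord_le c i
    have hmono : (1 + 2 * ε) ^ (loopWord P.L c.dir (off i.1) i.2.1 i.2.2).length ≤ (1 + 2 * ε) ^ ((P.d + 2) * P.L) :=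
      pow_le_pow_right₀ (by linarith) hlen
    calc ‖((loopVarU Uc' c i : (MatA N)ˣ) : MatA N) - 1‖
        ≤ ‖((loopVarU Uc' c i : (MatA N)ˣ) : MatA N) - loopVarU U' c i‖ + ‖((loopVarU U' c i : (MatA N)ˣ) : MatA N) - 1‖ := norm_sub_le_norm_sub_add_norm_sub _ _ _
      _ ≤ Q + r := add_le_add (h1.trans (by rw [hQ_def]; linarith)) (hWU i)
      _ = r + Q := add_comm _ _
  -- the `exp[mean log]` factors and the straight transporters
  have hE1 : ‖eml (fun i : Idx P => ((loopVarU Uc' c i : (MatA N)ˣ) : MatA N)) - 1‖ ≤ 6 * (r + Q) :=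
    BlockAveragingPlaquetteBound.norm_eml_sub_one_le_six_mul hWUc hrQ
  have hE2 : ‖eml (fun i : Idx P => ((loopVarU U' c i : (MatA N)ˣ) : MatA N)) - 1‖ ≤ 6 * r :=
    BlockAveragingPlaquetteBound.norm_eml_sub_one_le_six_mul hWU (by linarith)
  have hS : ‖((straightU Uc' c : (MatA N)ˣ) : MatA N) - straightU U' c‖ ≤ Q := by
    have h1 := norm_holT_factor_sub_holT_le hf' hU'1 hU'2 hε he' (emb c.src) (List.replicate P.L (c.dir, true))
    rw [List.length_replicate] at h1
    refine h1.trans ?_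
    rw [hQ_def]
    have : (1 + 2 * ε) ^ P.L ≤ (1 + 2 * ε) ^ ((P.d + 2) * P.L) := pow_le_pow_right₀ (by linarith) (by nlinarith [P.L_pos])
    linarith
  have hS2 : ‖((straightU U' c : (MatA N)ˣ) : MatA N)‖ ≤ 1 := norm_holT_le_one hU'1 hU'2 _ _
  have hS1 : ‖((straightU Uc' c : (MatA N)ˣ) : MatA N)‖ ≤ 1 + Q := by
    have := norm_le_norm_add_norm_sub' ((straightU Uc' c : (MatA N)ˣ) : MatA N) (straightU U' c : (MatA N)ˣ)
    linarith [norm_sub_rev ((straightU Uc' c : (MatA N)ˣ) : MatA N) (straightU U' c : (MatA N)ˣ)]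
  -- assemble
  rw [show avgUnits Uc c = avgUnits Uc' c from emlAvgU_congr₂ hj c hagree, show avgUnits U c = avgUnits U' c from emlAvgU_congr₂ hj c hagreeU,
    val_avgUnits, val_avgUnits]
  set E₁ := eml (fun i : Idx P => ((loopVarU Uc' c i : (MatA N)ˣ) : MatA N))
  set E₂ := eml (fun i : Idx P => ((loopVarU U' c i : (MatA N)ˣ) : MatA N))
  set S₁ := ((straightU Uc' c : (MatA N)ˣ) : MatA N)
  set S₂ := ((straightU U' c : (MatA N)ˣ) : MatA N)
  have hdec : E₁ * S₁ - E₂ * S₂ = (E₁ - 1) * S₁ - (E₂ - 1) * S₁ + E₂ * (S₁ - S₂) := by noncomm_ring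
  rw [hdec]
  have hE2n : ‖E₂‖ ≤ 1 + 6 * r := by
    have := norm_le_norm_add_norm_sub' E₂ 1
    rw [norm_one] at this
    linarith
  calc ‖(E₁ - 1) * S₁ - (E₂ - 1) * S₁ + E₂ * (S₁ - S₂)‖
      ≤ ‖(E₁ - 1) * S₁‖ + ‖(E₂ - 1) * S₁‖ + ‖E₂ * (S₁ - S₂)‖ := (norm_add_le _ _).trans (add_le_add (norm_sub_le _ _) le_rfl)
    _ ≤ ‖E₁ - 1‖ * ‖S₁‖ + ‖E₂ - 1‖ * ‖S₁‖ + ‖E₂‖ * ‖S₁ - S₂‖ :=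
        add_le_add (add_le_add (norm_mul_le _ _) (norm_mul_le _ _)) (norm_mul_le _ _)
    _ ≤ 6 * (r + Q) * (1 + Q) + 6 * r * (1 + Q) + (1 + 6 * r) * Q := by
        gcongr
    _ ≤ 22 * (r + Q) := by nlinarith

/-- ★ **`‖Ū(𝐔)(c)·Ū(U)(c)⁻¹ − 1‖ ≤ 22·(r + ((1+2ε)^ℓ − 1))`** under the same hypotheses and the guard `r < δ_N` (so that `Ū(U)(c) ∈ SU(N)`, FILE D, and `‖Ū(U)(c)⁻¹‖ ≤ 1`).
[cite: Balaban1985Averaging, (122)-(123) p.36; Balaban1987RG1, (0.4) p.253] -/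
theorem norm_avgUnits_mul_inv_sub_one_le (hj : 0 + 1 ≤ P.m + P.K) {FB : Frame P 0 (MatA N)} {cB : StepConsts} {α₀ α₁ : ℝ}
    {Uc U : PBond P 0 → (MatA N)ˣ} {A' : PBond P 0 → MatA N} (hf : Factors cB Uc U A') (hI : CondI (suModel N) FB cB α₀ U)
    (hII : CondII (suModel N) FB.X cB α₁ U A') (c : PBond P 1)
    (hXb : ∀ b : PBond P 0, (blockOf b.src = c.src ∨ blockOf b.src = c.tgt) → (blockOf b.tgt = c.src ∨ blockOf b.tgt = c.tgt) → b ∈ FB.X.bonds)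
    (hXp : ∀ p : Plaq P 0, (blockOf p.src = c.src ∨ blockOf p.src = c.tgt) →
      (blockOf (p.src.shift p.μ) = c.src ∨ blockOf (p.src.shift p.μ) = c.tgt) →
      (blockOf (p.src.shift p.ν) = c.src ∨ blockOf (p.src.shift p.ν) = c.tgt) →
      (blockOf ((p.src.shift p.μ).shift p.ν) = c.src ∨ blockOf ((p.src.shift p.μ).shift p.ν) = c.tgt) → p ∈ FB.X.plaqs)
    (hξ : 0 ≤ cB.ξ) (hα₀ : 0 ≤ α₀) (hα₁ : 0 ≤ α₁) (hξ₁ : cB.ξ * α₁ ≤ 1 / 4)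
    (hsm : ((((P.d + 2) * P.L : ℕ) : ℝ) ^ 2 / 4) * (α₀ * cB.ξ ^ 2) + ((1 + 2 * (2 * (cB.ξ * α₁))) ^ ((P.d + 2) * P.L) - 1) ≤ 1 / 2)
    (hguard : ((((P.d + 2) * P.L : ℕ) : ℝ) ^ 2 / 4) * (α₀ * cB.ξ ^ 2) < deltaSU (Fin N)) :
    ‖((avgUnits Uc c : (MatA N)ˣ) : MatA N) * (((avgUnits U c)⁻¹ : (MatA N)ˣ) : MatA N) - 1‖ ≤
      22 * (((((P.d + 2) * P.L : ℕ) : ℝ) ^ 2 / 4) * (α₀ * cB.ξ ^ 2) + ((1 + 2 * (2 * (cB.ξ * α₁))) ^ ((P.d + 2) * P.L) - 1)) := by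
  have hG : avgUnits U c ∈ (suModel N).G := avgUnits_factor_mem_suModel_G hj hI c hXb hXp hα₀ hguard
  have hinv : ‖(((avgUnits U c)⁻¹ : (MatA N)ˣ) : MatA N)‖ ≤ 1 := suModel_norm_le _ ((suModel N).G.inv_mem hG)
  have hid : ((avgUnits Uc c : (MatA N)ˣ) : MatA N) * (((avgUnits U c)⁻¹ : (MatA N)ˣ) : MatA N) - 1 =
      (((avgUnits Uc c : (MatA N)ˣ) : MatA N) - (avgUnits U c : (MatA N)ˣ)) * (((avgUnits U c)⁻¹ : (MatA N)ˣ) : MatA N) := by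
    rw [sub_mul, Units.mul_inv]
  rw [hid]
  refine (norm_mul_le _ _).trans ?_
  have h := norm_avgUnits_sub_avgUnits_factor_le hj hf hI hII c hXb hXp hξ hα₀ hα₁ hξ₁ hsm
  have h0 : 0 ≤ ‖((avgUnits Uc c : (MatA N)ˣ) : MatA N) - (avgUnits U c : (MatA N)ˣ)‖ := norm_nonneg _
  nlinarith

end Frame

/-! ## §2 At one bond: the logarithm of `X = Ū(𝐔)(c)·Ū(U)(c)⁻¹` -/

section Log

variable {N : ℕ} [NeZero N]

omit [NeZero N] in
/-- **`exp iξ′·((iξ′)⁻¹ log X)·V = W`** for units `W, V` of `M_N(ℂ)` with `X = W·V⁻¹`, `‖X − 1‖ < 1` (`exp log X = X`, `MatrixLog.exp_mlog`) and `ξ′ ≠ 0`.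
[cite: Balaban1985Averaging, (26)-(27) p.22] -/
theorem expI_log_mul_eq {ξ : ℝ} (hξ : ξ ≠ 0) (W V : (MatA N)ˣ) (hX : ‖(W : MatA N) * ((V⁻¹ : (MatA N)ˣ) : MatA N) - 1‖ < 1) :
    expI ξ ((I * (ξ : ℂ))⁻¹ • mlog ((W : MatA N) * ((V⁻¹ : (MatA N)ˣ) : MatA N))) * V = W := by
  refine Units.ext ?_
  rw [Units.val_mul, B12Lemma4Concrete.val_expI, smul_smul, mul_inv_cancel₀ (mul_ne_zero Complex.I_ne_zero (by exact_mod_cast hξ)), one_smul,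
    exp_mlog hX, mul_assoc, Units.inv_mul, mul_one]

omit [NeZero N] in
/-- **`tr((iξ′)⁻¹ log X) = 0`** when `det W = det V = 1`, `‖X − 1‖ ≤ 1∕3` and `N·‖X − 1‖ < π` (`ExpMeanLog.trace_mlog_eq_zero_of_det_eq_one` on `SL(N, ℂ)`).
[cite: Balaban1985Averaging, (20) p.21 and (26) p.22] -/
theorem trace_log_eq_zero (ξ : ℝ) (W V : (MatA N)ˣ) (hW : Matrix.det (W : MatA N) = 1) (hV : Matrix.det (V : MatA N) = 1)
    (h3 : ‖(W : MatA N) * ((V⁻¹ : (MatA N)ˣ) : MatA N) - 1‖ ≤ 1 / 3)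
    (hπ : (N : ℝ) * ‖(W : MatA N) * ((V⁻¹ : (MatA N)ˣ) : MatA N) - 1‖ < Real.pi) :
    Matrix.trace ((I * (ξ : ℂ))⁻¹ • mlog ((W : MatA N) * ((V⁻¹ : (MatA N)ˣ) : MatA N))) = 0 := by
  have hdet : Matrix.det ((W : MatA N) * ((V⁻¹ : (MatA N)ˣ) : MatA N)) = 1 := by
    rw [Matrix.det_mul, hW, one_mul]
    have h := congrArg Matrix.det (V.mul_inv)
    rw [Matrix.det_mul, hV, one_mul, Matrix.det_one] at h
    exact h
  rw [Matrix.trace_smul, ExpMeanLog.trace_mlog_eq_zero_of_det_eq_one hdet h3 (by simpa only [Fintype.card_fin] using hπ), smul_zero]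

omit [NeZero N] in
/-- **`‖(iξ′)⁻¹ log X‖ ≤ 2ρ∕ξ′`** when `‖X − 1‖ ≤ ρ ≤ 1∕2` and `0 < ξ′` ((26): `‖log X‖ ≤ 2‖X − 1‖`). [cite: Balaban1985Averaging, (26) p.22] -/
theorem norm_log_div_le {ξ ρ : ℝ} (hξ : 0 < ξ) {X : MatA N} (hX : ‖X - 1‖ ≤ ρ) (hρ : ρ ≤ 1 / 2) :
    ‖(I * (ξ : ℂ))⁻¹ • mlog X‖ ≤ 2 * ρ / ξ := by
  rw [norm_smul, norm_inv, norm_mul, Complex.norm_I, one_mul, Complex.norm_real, Real.norm_of_nonneg hξ.le]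
  rw [le_div_iff₀ hξ, mul_comm]
  have h := norm_mlog_le_two_mul (hX.trans hρ)
  have : ξ * (ξ⁻¹ * ‖mlog X‖) = ‖mlog X‖ := by field_simp
  nlinarith [this, hX]

omit [NeZero N] in
/-- **The CRUDE covariant-derivative letter**: `‖∇^ξ_{U,μ} A_ν(x)‖ ≤ 2a∕ξ` when `‖A‖ ≤ a` at the two bonds `⟨x, ν⟩, ⟨x + e_μ, ν⟩` and the transporter `U(x, μ)` has
`‖U‖, ‖U⁻¹‖ ≤ 1` (no cancellation used; [Balaban1985Averaging] Prop. 3's C¹ letter would give `O(α₁)` instead of `O(a∕ξ)`). [cite: Balaban1987RG1, (1.13) p.262] -/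
theorem norm_nabla_le_two_mul_div {P : Params} {ξ a : ℝ} (hξ : 0 < ξ) {U : PBond P 0 → (MatA N)ˣ} {A : PBond P 0 → MatA N} (x : Site P 0)
    (μ ν : Fin P.d) (hU : ‖((U ⟨x, μ⟩ : (MatA N)ˣ) : MatA N)‖ ≤ 1) (hU' : ‖(((U ⟨x, μ⟩)⁻¹ : (MatA N)ˣ) : MatA N)‖ ≤ 1)
    (h1 : ‖A ⟨x.shift μ, ν⟩‖ ≤ a) (h2 : ‖A ⟨x, ν⟩‖ ≤ a) :
    ‖nabla ξ U μ (fun y => A ⟨y, ν⟩) x‖ ≤ 2 * a / ξ := by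
  unfold nabla
  rw [norm_smul, norm_inv, Complex.norm_real, Real.norm_of_nonneg hξ.le, le_div_iff₀ hξ, mul_comm]
  have ha : 0 ≤ a := (norm_nonneg _).trans h2
  have hprod : ‖((U ⟨x, μ⟩ : (MatA N)ˣ) : MatA N) * A ⟨x.shift μ, ν⟩ * (((U ⟨x, μ⟩)⁻¹ : (MatA N)ˣ) : MatA N)‖ ≤ a := by
    refine (norm_mul_le _ _).trans ?_
    refine (mul_le_mul (norm_mul_le _ _) hU' (norm_nonneg _) (by positivity)).trans ?_
    calc ‖((U ⟨x, μ⟩ : (MatA N)ˣ) : MatA N)‖ * ‖A ⟨x.shift μ, ν⟩‖ * 1 ≤ 1 * a * 1 := by gcongr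
      _ = a := by ring
  have hsub := norm_sub_le (((U ⟨x, μ⟩ : (MatA N)ˣ) : MatA N) * A ⟨x.shift μ, ν⟩ * (((U ⟨x, μ⟩)⁻¹ : (MatA N)ˣ) : MatA N)) (A ⟨x, ν⟩)
  have hξξ : ξ * (ξ⁻¹ * ‖((U ⟨x, μ⟩ : (MatA N)ˣ) : MatA N) * A ⟨x.shift μ, ν⟩ * (((U ⟨x, μ⟩)⁻¹ : (MatA N)ˣ) : MatA N) - A ⟨x, ν⟩‖) =
      ‖((U ⟨x, μ⟩ : (MatA N)ˣ) : MatA N) * A ⟨x.shift μ, ν⟩ * (((U ⟨x, μ⟩)⁻¹ : (MatA N)ˣ) : MatA N) - A ⟨x, ν⟩‖ := by field_simp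
  nlinarith [hξξ, hsub, hprod, h2]

end Log

section Congr

variable {N : ℕ} [NeZero N]

omit [NeZero N] in
/-- **Condition (i) on a frame of record depends on the factor at the region's bonds only**: if `U = U′` on the bonds of `regionOfSet Y`, then
`CondI (suModel N) (frameI Rz M j Y) c α₀ U → CondI (suModel N) (frameI Rz M j Y) c α₀ U′` (plaquettes of the region have their four bonds in the region,
`Sect2.stencil_of_mem_plaqInside`; cube bonds are region bonds, `cubesI_bonds_subset`). [cite: Balaban1987RG1, (1.11)-(1.12) p.262 (bookkeeping)] -/
theorem condI_congr_frameI {P : Params} (Rz : Node00.Sect2.Residual P (MatA N)) (M j : ℕ) (Y : Set (Site P 0)) {c : StepConsts} {α₀ : ℝ}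
    {U U' : PBond P 0 → (MatA N)ˣ} (hUU' : ∀ b ∈ (regionOfSet P Y).bonds, U b = U' b) (h : CondI (suModel N) (frameI Rz M j Y) c α₀ U) :
    CondI (suModel N) (frameI Rz M j Y) c α₀ U' := by
  refine ⟨fun b hb => ?_, fun p hp => ?_, fun C hC => ?_⟩
  · rw [← hUU' b hb]; exact h.gValued b hb
  · obtain ⟨h1, h2, h3, h4, -, -⟩ := Node00.Sect2.stencil_of_mem_plaqInside (P := P) (Y := Y) hp
    rw [← plaq_congr_of_bonds p (hUU' _ h1) (hUU' _ h2) (hUU' _ h3) (hUU' _ h4)]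
    exact h.plaq_lt p hp
  · obtain ⟨u, hu, A, he, hA, hdA⟩ := h.localGauge C hC
    refine ⟨u, hu, A, fun bd hbd => ?_, hA, hdA⟩
    have hb : bd ∈ (regionOfSet P Y).bonds := YMDAG.N18.CombStep.cubesI_bonds_subset hC hbd
    have := he bd hbd
    simp only [gaugeU] at this ⊢
    rw [← hUU' bd hb]
    exact this

end Congr

end YMDAG.N18.TransportOfRecord

end
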